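import Summits.AtomisticToContinuum.HydrodynamicLimit.Theorems.InformationPercolationEngineChaosClosesEulerEntropyBalanceC
import HarnessLib

/-!
# Windowed entropy balance — helper D: the exact jump of the coarse-grained entropy density

Helper file for the registered stub `stub_windowedEntropyBalance` of the line `empirical-h-theorem`
(crux `InformationPercolationEngine.ChaosClosesEuler`, stmt-AtomisticToContinuum-15141).

WHAT. The velocity-level heart of the windowed entropy balance. For two configurations `w`
(post-collisional) and `w'` (pre-collisional) with the same positions and the same velocities
except for one pair `{p, q}` whose kinetic energy is unchanged, and every field point `x`, the
coarse-grained entropy density `S(x) = ∫ 𝔰_{y₀(v)}(g_x(v)) dv` of helper C jumps by EXACTLY the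
normalised entropic marks plus a second-order remainder:
`|S_{w'}(x) − S_w(x) − (N+1)⁻¹ Σₖ b_r(xₖ, x)(Λ̃_x(v'ₖ) − Λ̃_x(vₖ))| ≤ C_R⁰ (1 + |v_p|⁴ + |v_q|⁴)/(N+1)²`
(`abs_SC_jump_le`), `C_R⁰ = 16 e^K (3/(πr³))² φ_δ(0) c₄(δ)`. Proof: first-order Taylor expansion of
`𝔰` at `g_w` with the `y₀⁻¹ = e^K(1+|v|²)²`-Lipschitz derivative `1 + ℓ` (helper A); the term
`∫ 1·Δg = 0` (unit mass of the translates of `φ_δ`), the term `∫ ℓ(g_w) Δg` IS the sum of the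
marks (definition of `Λ̃`, evenness of `φ_δ`), and the remainder `≤ e^K ∫ (1+|v|²)² Δg²` is paid
by `Δg² ≤ 4 (N+1)⁻² (3/(πr³))² φ_δ(0) Σ φ_δ(· − a)` over the four velocities `v_p, v_q, v'_p, v'_q`
and the quartic Gaussian bound of helper B, with `|v'_p|⁴ + |v'_q|⁴ ≤ 2(|v_p|⁴ + |v_q|⁴)`.

References: L. Boltzmann (1872); folklore.
-/

noncomputable section

namespace Summit.AtomisticToContinuum.HydrodynamicLimit.Theorems.ChaosClosesEulerEntropyBalance

open scoped BigOperators Topology Classical MeasureTheory ENNReal InnerProductSpace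
open Filter Set MeasureTheory ProbabilityTheory
open Literature.MathematicalPhysics.KineticTheory
open Literature.Analysis.FluidPDE
open Summit.AtomisticToContinuum.HydrodynamicLimit.Theorems.LocalSecondLawNegative (cone rhoC cone_nonneg
  continuous_cone rhoC_nonneg continuous_rhoC)
open Summit.AtomisticToContinuum.HydrodynamicLimit.Theorems.ChaosClosesEulerWindowedInvariance (cone_nonneg_le)

variable {N : ℕ}

/-- The remainder constant `C_R⁰ = 16 e^K (3/(πr³))² φ_δ(0) c₄(δ)`. [folklore] -/
def CR0 (r δ K : ℝ) : ℝ := 16 * Real.exp K * (3 / (Real.pi * r ^ 3)) ^ 2 * phiMax δ * c4 δ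

/-! ## §1 The jump of the smoothed cone law -/

/-- Same positions: `Δg = (N+1)⁻¹ Σₖ b_r(xₖ, x)(φ_δ(v − v'ₖ) − φ_δ(v − vₖ))`. [folklore] -/
theorem gC_sub_eq_sum (r δ : ℝ) {w w' : Config (N + 1) (Fin 3) T3} (hpos : ∀ k, (w' k).1 = (w k).1) (x : T3)
    (v : V3) :
    gC r δ w' x v - gC r δ w x v =
      ((N + 1 : ℕ) : ℝ)⁻¹ * ∑ k, cone r (w k).1 x * (phi δ (v - (w' k).2) - phi δ (v - (w k).2)) := by
  rw [gC_eq_sum, gC_eq_sum, ← mul_sub, ← Finset.sum_sub_distrib]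
  congr 1
  exact Finset.sum_congr rfl fun k _ => by rw [hpos k, mul_sub]

/-- Only the pair jumps: `Δg = (N+1)⁻¹ (b_p (φ'_p − φ_p) + b_q (φ'_q − φ_q))`. [folklore] -/
theorem gC_sub_eq_pair (r δ : ℝ) {w w' : Config (N + 1) (Fin 3) T3} {p q : Fin (N + 1)} (hpq : p ≠ q)
    (hpos : ∀ k, (w' k).1 = (w k).1) (hvel : ∀ k, k ≠ p → k ≠ q → (w' k).2 = (w k).2) (x : T3) (v : V3) :
    gC r δ w' x v - gC r δ w x v = ((N + 1 : ℕ) : ℝ)⁻¹ *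
      (cone r (w p).1 x * (phi δ (v - (w' p).2) - phi δ (v - (w p).2)) +
        cone r (w q).1 x * (phi δ (v - (w' q).2) - phi δ (v - (w q).2))) := by
  rw [gC_sub_eq_sum r δ hpos, Fintype.sum_eq_add p q hpq]
  intro k hk
  rw [hvel k hk.1 hk.2, sub_self, mul_zero]

/-- `|Δg| ≤ (N+1)⁻¹ (3/(πr³)) Ψ`, `Ψ` the sum of the four Gaussian bumps. [folklore] -/
theorem abs_gC_sub_le {r δ : ℝ} (hr : 0 < r) (hδ : 0 < δ) {w w' : Config (N + 1) (Fin 3) T3}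
    {p q : Fin (N + 1)} (hpq : p ≠ q) (hpos : ∀ k, (w' k).1 = (w k).1)
    (hvel : ∀ k, k ≠ p → k ≠ q → (w' k).2 = (w k).2) (x : T3) (v : V3) :
    |gC r δ w' x v - gC r δ w x v| ≤ ((N + 1 : ℕ) : ℝ)⁻¹ * (3 / (Real.pi * r ^ 3)) *
      (phi δ (v - (w' p).2) + phi δ (v - (w p).2) + phi δ (v - (w' q).2) + phi δ (v - (w q).2)) := by
  rw [gC_sub_eq_pair r δ hpq hpos hvel, abs_mul, abs_of_nonneg (by positivity : (0 : ℝ) ≤ ((N + 1 : ℕ) : ℝ)⁻¹),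
    mul_assoc]
  refine mul_le_mul_of_nonneg_left ?_ (by positivity)
  have hc := fun y => cone_nonneg_le hr y x
  have hφ := phi_nonneg hδ
  have h1 : |cone r (w p).1 x * (phi δ (v - (w' p).2) - phi δ (v - (w p).2))| ≤
      3 / (Real.pi * r ^ 3) * (phi δ (v - (w' p).2) + phi δ (v - (w p).2)) := by
    rw [abs_mul, abs_of_nonneg (cone_nonneg hr _ _)]
    exact mul_le_mul (hc _).2 ((abs_sub _ _).trans (by rw [abs_of_nonneg (hφ _), abs_of_nonneg (hφ _)]))
      (abs_nonneg _) (by positivity)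
  have h2 : |cone r (w q).1 x * (phi δ (v - (w' q).2) - phi δ (v - (w q).2))| ≤
      3 / (Real.pi * r ^ 3) * (phi δ (v - (w' q).2) + phi δ (v - (w q).2)) := by
    rw [abs_mul, abs_of_nonneg (cone_nonneg hr _ _)]
    exact mul_le_mul (hc _).2 ((abs_sub _ _).trans (by rw [abs_of_nonneg (hφ _), abs_of_nonneg (hφ _)]))
      (abs_nonneg _) (by positivity)
  calc _ ≤ _ := abs_add_le _ _
    _ ≤ _ := add_le_add h1 h2
    _ = _ := by ring

/-- `Δg² ≤ 4 ((N+1)⁻¹ 3/(πr³))² φ_δ(0) Ψ`. [folklore] -/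
theorem gC_sub_sq_le {r δ : ℝ} (hr : 0 < r) (hδ : 0 < δ) {w w' : Config (N + 1) (Fin 3) T3}
    {p q : Fin (N + 1)} (hpq : p ≠ q) (hpos : ∀ k, (w' k).1 = (w k).1)
    (hvel : ∀ k, k ≠ p → k ≠ q → (w' k).2 = (w k).2) (x : T3) (v : V3) :
    (gC r δ w' x v - gC r δ w x v) ^ 2 ≤ 4 * (((N + 1 : ℕ) : ℝ)⁻¹ * (3 / (Real.pi * r ^ 3))) ^ 2 * phiMax δ *
      (phi δ (v - (w' p).2) + phi δ (v - (w p).2) + phi δ (v - (w' q).2) + phi δ (v - (w q).2)) := by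
  have h := abs_gC_sub_le hr hδ hpq hpos hvel x v
  set A := ((N + 1 : ℕ) : ℝ)⁻¹ * (3 / (Real.pi * r ^ 3)) with hA
  set a := phi δ (v - (w' p).2)
  set b := phi δ (v - (w p).2)
  set c := phi δ (v - (w' q).2)
  set d := phi δ (v - (w q).2)
  have hA0 : 0 ≤ A := by positivity
  have ha := phi_nonneg hδ (v - (w' p).2); have hb := phi_nonneg hδ (v - (w p).2)
  have hc := phi_nonneg hδ (v - (w' q).2); have hd := phi_nonneg hδ (v - (w q).2)
  have haM := phi_le_phiMax δ (v - (w' p).2); have hbM := phi_le_phiMax δ (v - (w p).2)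
  have hcM := phi_le_phiMax δ (v - (w' q).2); have hdM := phi_le_phiMax δ (v - (w q).2)
  have hsq : (gC r δ w' x v - gC r δ w x v) ^ 2 ≤ (A * (a + b + c + d)) ^ 2 := by
    rw [← sq_abs]; exact pow_le_pow_left₀ (abs_nonneg _) h 2
  have h4 : (a + b + c + d) ^ 2 ≤ 4 * (a ^ 2 + b ^ 2 + c ^ 2 + d ^ 2) := by
    nlinarith [sq_nonneg (a - b), sq_nonneg (a - c), sq_nonneg (a - d), sq_nonneg (b - c), sq_nonneg (b - d),
      sq_nonneg (c - d)]
  have h5 : a ^ 2 + b ^ 2 + c ^ 2 + d ^ 2 ≤ phiMax δ * (a + b + c + d) := by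
    nlinarith [mul_le_mul_of_nonneg_left haM ha, mul_le_mul_of_nonneg_left hbM hb,
      mul_le_mul_of_nonneg_left hcM hc, mul_le_mul_of_nonneg_left hdM hd]
  calc (gC r δ w' x v - gC r δ w x v) ^ 2 ≤ A ^ 2 * (a + b + c + d) ^ 2 := by rw [← mul_pow]; exact hsq
    _ ≤ A ^ 2 * (4 * (phiMax δ * (a + b + c + d))) :=
        mul_le_mul_of_nonneg_left (h4.trans (by linarith)) (sq_nonneg A)
    _ = _ := by ring

/-! ## §2 Integrability and the two exact velocity integrals -/

/-- `Δg` is integrable. [folklore] -/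
theorem integrable_gC_sub {r δ : ℝ} (hδ : 0 < δ) {w w' : Config (N + 1) (Fin 3) T3}
    (hpos : ∀ k, (w' k).1 = (w k).1) (x : T3) : Integrable fun v => gC r δ w' x v - gC r δ w x v := by
  have h : (fun v => gC r δ w' x v - gC r δ w x v) = fun v =>
      ((N + 1 : ℕ) : ℝ)⁻¹ * ∑ k, cone r (w k).1 x * (phi δ (v - (w' k).2) - phi δ (v - (w k).2)) :=
    funext fun v => gC_sub_eq_sum r δ hpos x v
  rw [h]
  have hI : ∀ k, Integrable fun v => cone r (w k).1 x * (phi δ (v - (w' k).2) - phi δ (v - (w k).2)) :=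
    fun k => ((integrable_phi_sub hδ _).sub (integrable_phi_sub hδ _)).const_mul _
  exact (integrable_finsetSum _ fun k _ => hI k).const_mul _

/-- `∫ Δg = 0` (every translate of `φ_δ` has unit mass). [folklore] -/
theorem integral_gC_sub {r δ : ℝ} (hδ : 0 < δ) {w w' : Config (N + 1) (Fin 3) T3}
    (hpos : ∀ k, (w' k).1 = (w k).1) (x : T3) : ∫ v, (gC r δ w' x v - gC r δ w x v) = 0 := by
  have h : (fun v => gC r δ w' x v - gC r δ w x v) = fun v =>
      ((N + 1 : ℕ) : ℝ)⁻¹ * ∑ k, cone r (w k).1 x * (phi δ (v - (w' k).2) - phi δ (v - (w k).2)) :=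
    funext fun v => gC_sub_eq_sum r δ hpos x v
  have hI : ∀ k, Integrable fun v => cone r (w k).1 x * (phi δ (v - (w' k).2) - phi δ (v - (w k).2)) :=
    fun k => ((integrable_phi_sub hδ _).sub (integrable_phi_sub hδ _)).const_mul _
  rw [h, integral_const_mul, integral_finsetSum _ fun k _ => hI k]
  refine mul_eq_zero_of_right _ (Finset.sum_eq_zero fun k _ => ?_)
  have h1 : Integrable fun v => phi δ (v - (w' k).2) := integrable_phi_sub hδ _
  have h2 : Integrable fun v => phi δ (v - (w k).2) := integrable_phi_sub hδ _
  rw [integral_const_mul, integral_sub h1 h2, integral_phi_sub hδ, integral_phi_sub hδ, sub_self, mul_zero]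

/-- `ℓ(g_w) φ_δ(· − a)` is integrable (mark integrand, commuted). [folklore] -/
theorem integrable_flog_gC_mul_phi {r δ : ℝ} (hr : 0 < r) (hδ : 0 < δ) (K : ℝ) (w : Config (N + 1) (Fin 3) T3)
    (x : T3) (a : V3) : Integrable fun v => flog (yfl K v) (gC r δ w x v) * phi δ (v - a) := by
  have h := integrable_phi_mul_flog_gC hr hδ K w x a
  exact h.congr (Eventually.of_forall fun v => mul_comm _ _)

/-- `∫ ℓ(g_w)(v) φ_δ(v − a) dv = Λ̃_x(a)`. [folklore] -/
theorem integral_flog_gC_mul_phi {r δ : ℝ} (K : ℝ) (w : Config (N + 1) (Fin 3) T3) (x : T3) (a : V3) :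
    ∫ v, flog (yfl K v) (gC r δ w x v) * phi δ (v - a) = LamC r δ K w x a := by
  rw [LamC_eq]
  exact integral_congr_ae (Eventually.of_forall fun v => mul_comm _ _)

/-- `ℓ(g_w) Δg` is integrable. [folklore] -/
theorem integrable_flog_mul_gC_sub {r δ : ℝ} (hr : 0 < r) (hδ : 0 < δ) (K : ℝ) {w w' : Config (N + 1) (Fin 3) T3}
    (hpos : ∀ k, (w' k).1 = (w k).1) (x : T3) :
    Integrable fun v => flog (yfl K v) (gC r δ w x v) * (gC r δ w' x v - gC r δ w x v) := by
  have h : (fun v => flog (yfl K v) (gC r δ w x v) * (gC r δ w' x v - gC r δ w x v)) = fun v =>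
      ((N + 1 : ℕ) : ℝ)⁻¹ * ∑ k, cone r (w k).1 x *
        (flog (yfl K v) (gC r δ w x v) * phi δ (v - (w' k).2) - flog (yfl K v) (gC r δ w x v) * phi δ (v - (w k).2)) := by
    funext v
    rw [gC_sub_eq_sum r δ hpos x v, Finset.mul_sum, Finset.mul_sum, Finset.mul_sum]
    exact Finset.sum_congr rfl fun k _ => by ring
  rw [h]
  have hI : ∀ k, Integrable fun v => cone r (w k).1 x *
      (flog (yfl K v) (gC r δ w x v) * phi δ (v - (w' k).2) - flog (yfl K v) (gC r δ w x v) * phi δ (v - (w k).2)) :=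
    fun k => ((integrable_flog_gC_mul_phi hr hδ K w x _).sub (integrable_flog_gC_mul_phi hr hδ K w x _)).const_mul _
  exact (integrable_finsetSum _ fun k _ => hI k).const_mul _

/-- **The first-order term IS the sum of the entropic marks**:
`∫ ℓ(g_w) Δg = (N+1)⁻¹ Σₖ b_r(xₖ, x)(Λ̃_x(v'ₖ) − Λ̃_x(vₖ))`. [folklore] -/
theorem integral_flog_mul_gC_sub {r δ : ℝ} (hr : 0 < r) (hδ : 0 < δ) (K : ℝ) {w w' : Config (N + 1) (Fin 3) T3}
    (hpos : ∀ k, (w' k).1 = (w k).1) (x : T3) :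
    ∫ v, flog (yfl K v) (gC r δ w x v) * (gC r δ w' x v - gC r δ w x v) =
      ((N + 1 : ℕ) : ℝ)⁻¹ * ∑ k, cone r (w k).1 x * (LamC r δ K w x (w' k).2 - LamC r δ K w x (w k).2) := by
  have h : (fun v => flog (yfl K v) (gC r δ w x v) * (gC r δ w' x v - gC r δ w x v)) = fun v =>
      ((N + 1 : ℕ) : ℝ)⁻¹ * ∑ k, cone r (w k).1 x *
        (flog (yfl K v) (gC r δ w x v) * phi δ (v - (w' k).2) - flog (yfl K v) (gC r δ w x v) * phi δ (v - (w k).2)) := by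
    funext v
    rw [gC_sub_eq_sum r δ hpos x v, Finset.mul_sum, Finset.mul_sum, Finset.mul_sum]
    exact Finset.sum_congr rfl fun k _ => by ring
  have hI : ∀ k, Integrable fun v => cone r (w k).1 x *
      (flog (yfl K v) (gC r δ w x v) * phi δ (v - (w' k).2) - flog (yfl K v) (gC r δ w x v) * phi δ (v - (w k).2)) :=
    fun k => ((integrable_flog_gC_mul_phi hr hδ K w x _).sub (integrable_flog_gC_mul_phi hr hδ K w x _)).const_mul _
  rw [h, integral_const_mul, integral_finsetSum _ fun k _ => hI k]
  congr 1
  refine Finset.sum_congr rfl fun k _ => ?_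
  have h1 : Integrable fun v => flog (yfl K v) (gC r δ w x v) * phi δ (v - (w' k).2) :=
    integrable_flog_gC_mul_phi hr hδ K w x _
  have h2 : Integrable fun v => flog (yfl K v) (gC r δ w x v) * phi δ (v - (w k).2) :=
    integrable_flog_gC_mul_phi hr hδ K w x _
  rw [integral_const_mul, integral_sub h1 h2, integral_flog_gC_mul_phi, integral_flog_gC_mul_phi]

/-! ## §3 The quartic remainder -/

/-- `(1 + |v|²)² φ_δ(v − a)` is integrable. [folklore] -/
theorem integrable_env_mul_phi {δ : ℝ} (hδ : 0 < δ) (a : V3) :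
    Integrable fun v => (1 + ‖v‖ ^ 2) ^ 2 * phi δ (v - a) := by
  have h := integrable_phi_sub_mul hδ (F := fun v => (1 + ‖v‖ ^ 2) ^ 2) (by fun_prop) (C := 1)
    (fun v => by rw [one_mul, abs_of_nonneg (by positivity)]) a
  exact h.congr (Eventually.of_forall fun v => mul_comm _ _)

/-- `∫ (1 + |v|²)² φ_δ(v − a) dv ≤ c₄(δ)(1 + |a|⁴)`. [folklore] -/
theorem integral_env_mul_phi_le {δ : ℝ} (hδ : 0 < δ) (a : V3) :
    ∫ v, (1 + ‖v‖ ^ 2) ^ 2 * phi δ (v - a) ≤ c4 δ * (1 + ‖a‖ ^ 4) := by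
  have h := integral_phi_env_le hδ a
  rwa [show (fun v => phi δ (v - a) * (1 + ‖v‖ ^ 2) ^ 2) = fun v => (1 + ‖v‖ ^ 2) ^ 2 * phi δ (v - a) from
    funext fun v => mul_comm _ _] at h

/-- Energy conservation of the pair controls the pre-collisional quartic moments:
`|v'_p|⁴ + |v'_q|⁴ ≤ 2(|v_p|⁴ + |v_q|⁴)`. [folklore] -/
theorem quartic_pre_le {a b a' b' : ℝ} (h : a' ^ 2 + b' ^ 2 = a ^ 2 + b ^ 2) :
    a' ^ 4 + b' ^ 4 ≤ 2 * (a ^ 4 + b ^ 4) := by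
  have h1 : a' ^ 4 + b' ^ 4 ≤ (a' ^ 2 + b' ^ 2) ^ 2 := by nlinarith [sq_nonneg a', sq_nonneg b']
  rw [h] at h1
  nlinarith [sq_nonneg (a ^ 2 - b ^ 2)]

/-- **The quartic remainder bound**:
`e^K ∫ (1+|v|²)² Δg² ≤ C_R⁰ (1 + |v_p|⁴ + |v_q|⁴)/(N+1)²`. [folklore] -/
theorem integral_rem_le {r δ : ℝ} (hr : 0 < r) (hδ : 0 < δ) (K : ℝ) {w w' : Config (N + 1) (Fin 3) T3}
    {p q : Fin (N + 1)} (hen : ‖(w' p).2‖ ^ 2 + ‖(w' q).2‖ ^ 2 = ‖(w p).2‖ ^ 2 + ‖(w q).2‖ ^ 2) :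
    Integrable (fun v => Real.exp K * (1 + ‖v‖ ^ 2) ^ 2 * (4 * (((N + 1 : ℕ) : ℝ)⁻¹ * (3 / (Real.pi * r ^ 3))) ^ 2 *
      phiMax δ * (phi δ (v - (w' p).2) + phi δ (v - (w p).2) + phi δ (v - (w' q).2) + phi δ (v - (w q).2)))) ∧
    ∫ v, Real.exp K * (1 + ‖v‖ ^ 2) ^ 2 * (4 * (((N + 1 : ℕ) : ℝ)⁻¹ * (3 / (Real.pi * r ^ 3))) ^ 2 *
      phiMax δ * (phi δ (v - (w' p).2) + phi δ (v - (w p).2) + phi δ (v - (w' q).2) + phi δ (v - (w q).2))) ≤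
      CR0 r δ K * (1 + ‖(w p).2‖ ^ 4 + ‖(w q).2‖ ^ 4) / ((N + 1 : ℕ) : ℝ) ^ 2 := by
  set A := ((N + 1 : ℕ) : ℝ)⁻¹ * (3 / (Real.pi * r ^ 3)) with hA
  set C0 := Real.exp K * (4 * A ^ 2 * phiMax δ) with hC0
  have hC0' : 0 ≤ C0 := by have := (phiMax_pos hδ).le; positivity
  have hI := fun a => integrable_env_mul_phi hδ a (δ := δ)
  set e : V3 → ℝ := fun v => (1 + ‖v‖ ^ 2) ^ 2 with he
  have heq : (fun v => Real.exp K * (1 + ‖v‖ ^ 2) ^ 2 * (4 * A ^ 2 * phiMax δ *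
      (phi δ (v - (w' p).2) + phi δ (v - (w p).2) + phi δ (v - (w' q).2) + phi δ (v - (w q).2)))) =
      fun v => C0 * (e v * phi δ (v - (w' p).2) + e v * phi δ (v - (w p).2) + e v * phi δ (v - (w' q).2) +
        e v * phi δ (v - (w q).2)) := by
    funext v; simp only [hC0, he]; ring
  have hA1 : Integrable fun v => e v * phi δ (v - (w' p).2) := hI _
  have hA2 : Integrable fun v => e v * phi δ (v - (w p).2) := hI _
  have hA3 : Integrable fun v => e v * phi δ (v - (w' q).2) := hI _
  have hA4 : Integrable fun v => e v * phi δ (v - (w q).2) := hI _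
  have hA12 : Integrable fun v => e v * phi δ (v - (w' p).2) + e v * phi δ (v - (w p).2) := hA1.add hA2
  have hA123 : Integrable fun v => e v * phi δ (v - (w' p).2) + e v * phi δ (v - (w p).2) +
      e v * phi δ (v - (w' q).2) := hA12.add hA3
  have hI4 : Integrable fun v => e v * phi δ (v - (w' p).2) + e v * phi δ (v - (w p).2) +
      e v * phi δ (v - (w' q).2) + e v * phi δ (v - (w q).2) := hA123.add hA4
  refine ⟨by rw [heq]; exact hI4.const_mul _, ?_⟩
  rw [heq, integral_const_mul, integral_add hA123 hA4, integral_add hA12 hA3, integral_add hA1 hA2]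
  have h1 := integral_env_mul_phi_le hδ (w' p).2
  have h2 := integral_env_mul_phi_le hδ (w p).2
  have h3 := integral_env_mul_phi_le hδ (w' q).2
  have h4 := integral_env_mul_phi_le hδ (w q).2
  have hq := quartic_pre_le hen
  have hc4 := (c4_pos δ).le
  have hsum : (∫ v, e v * phi δ (v - (w' p).2)) + (∫ v, e v * phi δ (v - (w p).2)) +
      (∫ v, e v * phi δ (v - (w' q).2)) + (∫ v, e v * phi δ (v - (w q).2)) ≤
      c4 δ * (4 * (1 + ‖(w p).2‖ ^ 4 + ‖(w q).2‖ ^ 4)) := by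
    simp only [he] at h1 h2 h3 h4 ⊢
    have hq' := mul_le_mul_of_nonneg_left hq hc4
    have hca : 0 ≤ c4 δ * ‖(w p).2‖ ^ 4 := by positivity
    have hcb : 0 ≤ c4 δ * ‖(w q).2‖ ^ 4 := by positivity
    linarith
  have hN : (0 : ℝ) < ((N + 1 : ℕ) : ℝ) := by positivity
  calc C0 * ((∫ v, e v * phi δ (v - (w' p).2)) + (∫ v, e v * phi δ (v - (w p).2)) +
        (∫ v, e v * phi δ (v - (w' q).2)) + (∫ v, e v * phi δ (v - (w q).2)))
      ≤ C0 * (c4 δ * (4 * (1 + ‖(w p).2‖ ^ 4 + ‖(w q).2‖ ^ 4))) := mul_le_mul_of_nonneg_left hsum hC0'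
    _ = CR0 r δ K * (1 + ‖(w p).2‖ ^ 4 + ‖(w q).2‖ ^ 4) / ((N + 1 : ℕ) : ℝ) ^ 2 := by
        simp only [hC0, hA, CR0]
        field_simp
        ring

/-! ## §4 The exact jump of `S(x)` -/

/-- **Exact jump of the coarse-grained entropy density.** Same positions, velocities changed only on
the pair `{p, q}` with its kinetic energy conserved: `S_{w'}(x) − S_w(x)` equals
`(N+1)⁻¹ Σₖ b_r(xₖ, x)(Λ̃_{w,x}(v'ₖ) − Λ̃_{w,x}(vₖ))` up to `C_R⁰ (1 + |v_p|⁴ + |v_q|⁴)/(N+1)²`. [folklore] -/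
theorem abs_SC_jump_le {r δ : ℝ} (hr : 0 < r) (hδ : 0 < δ) (K : ℝ) {w w' : Config (N + 1) (Fin 3) T3}
    {p q : Fin (N + 1)} (hpq : p ≠ q) (hpos : ∀ k, (w' k).1 = (w k).1)
    (hvel : ∀ k, k ≠ p → k ≠ q → (w' k).2 = (w k).2)
    (hen : ‖(w' p).2‖ ^ 2 + ‖(w' q).2‖ ^ 2 = ‖(w p).2‖ ^ 2 + ‖(w q).2‖ ^ 2) (x : T3) :
    |SC r δ K w' x - SC r δ K w x -
        ((N + 1 : ℕ) : ℝ)⁻¹ * ∑ k, cone r (w k).1 x * (LamC r δ K w x (w' k).2 - LamC r δ K w x (w k).2)| ≤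
      CR0 r δ K * (1 + ‖(w p).2‖ ^ 4 + ‖(w q).2‖ ^ 4) / ((N + 1 : ℕ) : ℝ) ^ 2 := by
  set g := gC r δ w x with hg
  set g' := gC r δ w' x with hg'
  -- the pieces
  set T₁ : V3 → ℝ := fun v => (1 + flog (yfl K v) (g v)) * (g' v - g v) with hT₁
  set R : V3 → ℝ := fun v => sK (yfl K v) (g' v) - sK (yfl K v) (g v) - T₁ v with hR
  have hIs : Integrable fun v => sK (yfl K v) (g v) := integrable_sK_gC hr hδ K w x
  have hIs' : Integrable fun v => sK (yfl K v) (g' v) := integrable_sK_gC hr hδ K w' x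
  have hIΔ : Integrable fun v => g' v - g v := integrable_gC_sub hδ hpos x
  have hIfΔ : Integrable fun v => flog (yfl K v) (g v) * (g' v - g v) := integrable_flog_mul_gC_sub hr hδ K hpos x
  have hIT : Integrable T₁ := by
    have h := hIΔ.add hIfΔ
    refine h.congr (Eventually.of_forall fun v => ?_)
    simp only [hT₁, Pi.add_apply]; ring
  have hIR : Integrable R := (hIs'.sub hIs).sub hIT
  -- the exact first-order part
  have hT_int : ∫ v, T₁ v = ((N + 1 : ℕ) : ℝ)⁻¹ * ∑ k, cone r (w k).1 x *
      (LamC r δ K w x (w' k).2 - LamC r δ K w x (w k).2) := by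
    have h1 : ∫ v, T₁ v = (∫ v, (g' v - g v)) + ∫ v, flog (yfl K v) (g v) * (g' v - g v) := by
      rw [← integral_add hIΔ hIfΔ]
      exact integral_congr_ae (Eventually.of_forall fun v => by simp only [hT₁]; ring)
    rw [h1, integral_gC_sub hδ hpos x, zero_add, integral_flog_mul_gC_sub hr hδ K hpos x]
  -- the jump as first-order part plus remainder
  have hsplit : SC r δ K w' x - SC r δ K w x = (∫ v, T₁ v) + ∫ v, R v := by
    unfold SC
    rw [← integral_sub hIs' hIs, ← integral_add hIT hIR]
    exact integral_congr_ae (Eventually.of_forall fun v => by simp only [hR]; ring)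
  rw [hsplit, hT_int, add_sub_cancel_left]
  -- the remainder
  obtain ⟨hIB, hB⟩ := integral_rem_le hr hδ K hen
  refine le_trans ?_ hB
  refine (abs_integral_le_integral_abs).trans (integral_mono_of_nonneg (Eventually.of_forall fun v => abs_nonneg _)
    hIB (Eventually.of_forall fun v => ?_))
  have h1 : |R v| ≤ Real.exp K * (1 + ‖v‖ ^ 2) ^ 2 * (g' v - g v) ^ 2 := by
    have h := abs_sK_sub_sub_le (yfl_pos K v) (g v) (g' v)
    rw [div_eq_mul_inv, inv_yfl] at h
    simp only [hR, hT₁]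
    linarith
  have h2 := gC_sub_sq_le hr hδ hpq hpos hvel x v
  exact h1.trans (mul_le_mul_of_nonneg_left h2 (by positivity))

/-- REGISTERED SUB-GOAL `stub_windowedEntropyBalanceD` of the line `empirical-h-theorem` (crux
stmt-AtomisticToContinuum-15141): energy conservation of a colliding pair controls its pre-collisional
quartic moments, `a'⁴ + b'⁴ ≤ 2(a⁴ + b⁴)` whenever `a'² + b'² = a² + b²` (restating
`quartic_pre_le`). [folklore] -/
theorem stub_windowedEntropyBalanceD : ∀ (a b a' b' : ℝ), a' ^ 2 + b' ^ 2 = a ^ 2 + b ^ 2 →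
    a' ^ 4 + b' ^ 4 ≤ 2 * (a ^ 4 + b ^ 4) :=
  fun _ _ _ _ h => quartic_pre_le h

end Summit.AtomisticToContinuum.HydrodynamicLimit.Theorems.ChaosClosesEulerEntropyBalance

end
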